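import Summits.CriticalPhenomena.PercolationContinuityZ3.Theorems.FK.MagnetizationLargeDeviations
import Summits.CriticalPhenomena.PercolationContinuityZ3.Theorems.FK.NoLatentHeat
import Summits.CriticalPhenomena.PercolationContinuityZ3.Theorems.FK.PressureBetaDerivativeField
import Summits.CriticalPhenomena.PercolationContinuityZ3.Theorems.FK.PlanarPressureBetaSmooth
import HarnessLib

/-!
# LARGE DEVIATIONS OF THE ENERGY: `⟨e^{−s H_Λ}⟩^{bc}_{Λ;β,h} = Z^{bc}_{Λ;β+s,h}/Z^{bc}_{Λ;β,h}`, CHERNOFF BOUNDS, AND THE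
# EXPONENTIAL LAW OF LARGE NUMBERS FOR THE ENERGY DENSITY `−H_N/|Λ_N| →exp ∂ψ/∂β` WHEREVER `ψ(·,h)` IS DIFFERENTIABLE —
# AT `h ≠ 0`, AT `h = 0` FOR `β ≤ β_c` INCLUDING `β_c` (NO LATENT HEAT), AND AT EVERY `β` IN `d = 2` (Ellis 2006 §II.6, §IV.5–IV.7)

Claimed R42 (8)(c) in the cell INBOX at 2026-08-29T07:56:28Z by fkp-10a gen 359 (NEW CLAIM #3 of the gen), addressed to coordinator fk-4 gen 294 (seated 06:59Z 2026-08-29 by l.8791; R172 l.8793 / R173 l.8802 in force; ruling R174 requested); lineage row FO-10a-g359e (self-suggested), package g359-energy, label LD-G.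
Helper file of the `fk-continuity` build cell (bschramm lane; `--supports stmt-CriticalPhenomena-4575`); builds on
p205010 (kernel theorem, internal audit signed; external expert review pending). No definitions, no named facts, no
sorries; standard axioms. UNCONDITIONAL (nearest-neighbour Ising model; finite volume on ANY locally finite graph with
ANY boundary condition for the identities and Chernoff bounds; `ℤ^d` boxes `Λ_N = {−N,…,N}^d`, EVERY boundary condition
for the asymptotics; the "energy" is `−H^{bc}_{Λ;h}(σ) = Σ_{e∈ℰ^{bc}_Λ} σ_e + h Σ_{x∈Λ} σ_x`, the tree's Hamiltonian).

The inverse temperature tilts the Gibbs measure by the energy exactly as the field tilts it by the total spin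
(`MagnetizationChernoffBounds`): `μ^{bc}_{Λ;β+s,h} = μ^{bc}_{Λ;β,h}.tilted(−s H)`, so the free energy function of
`−H_Λ` under `μ^{bc}_{Λ;β,h}` is `log Z_{β+s} − log Z_β = |Λ|(ψ^{bc}_Λ(β+s,h) − ψ^{bc}_Λ(β,h))` (Ellis §IV.7, (4.33) with
`β` in place of `h`), whose limit is `ψ(β+s,h) − ψ(β,h)`; Ellis' Thm. II.6.3 then gives exponential convergence of the
energy density exactly where `ψ(·,h)` is differentiable — which the tree knows: at every `h ≠ 0`
(`PressureBetaDerivativeField`), at `h = 0` for `0 < β ≤ β_c` INCLUDING the critical point (`NoLatentHeat`), at every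
`β` for `d = 2` (`PlanarPressureBetaSmooth`), and in general iff `Σᵢ⟨σ_0σ_{eᵢ}⟩^∅_β = Σᵢ⟨σ_0σ_{eᵢ}⟩⁺_β` (Lebowitz 1977,
`PressureBetaDerivative`):

* `isingMeasure_add_beta_eq_tilted`, **`integral_exp_neg_mul_isingHamiltonian`** (`⟨e^{−sH}⟩_β = Z_{β+s}/Z_β`),
  `mgf_neg_isingHamiltonian`, `cgf_neg_isingHamiltonian(_eq_card_mul)`;
* Chernoff: `measureReal_le_neg_isingHamiltonian_le` (`μ_β{a ≤ −H} ≤ e^{−sa} Z_{β+s}/Z_β`, `s ≥ 0`),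
  `measureReal_neg_isingHamiltonian_le_le` (`μ_β{−H ≤ a} ≤ e^{sa} Z_{β−s}/Z_β`) and the pressure forms `…_exp_card`;
* `ℤ^d`: `eventually_measureReal_le_neg_isingHamiltonian_le` / `…_le_le` (LD upper bounds for half-lines, rate
  `sa − (ψ(β+s,h) − ψ(β,h))`), `exists_pos_rate_of_hasDerivWithinAt_Ici/_Iic` (pure: one-sided derivative ⇒ positive
  rate), **`energy_upper_tail_exp_decay_of_hasDerivWithinAt`** / **`energy_lower_tail_exp_decay_of_hasDerivWithinAt`**,
  **`energy_exp_concentration_of_hasDerivAt`** (Ellis II.6.3 (b) ⇒ (a) for the energy, every b.c.);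
* ISING SPECIALISATIONS: **`energy_upper_tail_exp_decay_plus_nn`** / **`energy_lower_tail_exp_decay_free_nn`** — at
  `h = 0`, EVERY `β`, every b.c.: the energy density does not exceed `Σᵢ⟨σ_0σ_{eᵢ}⟩⁺_β + ε` nor fall below
  `Σᵢ⟨σ_0σ_{eᵢ}⟩^∅_β − ε` except at volume-order exponential cost (one-sided `β`-derivatives, Lebowitz);
  **`energy_exp_concentration_of_le_criticalBeta`** (`d ≥ 2`, `0 < β ≤ β_c`, `h = 0`: `−H_N/|Λ_N| →exp Σᵢ⟨σ_0σ_{eᵢ}⟩⁺_β`),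
  **`energy_exp_concentration_criticalBeta`** (AT `β_c`: NO LATENT HEAT ⇒ exponential concentration of the critical
  energy density), `energy_exp_concentration_of_nn_freeCorr_eq_plusCorr` (Lebowitz' criterion),
  `energy_exp_concentration_pos_field` (`h > 0`, every `β > 0`), `energy_exp_concentration_two` (`d = 2`, every `β > 0`).

## References

* R. S. Ellis, *Entropy, Large Deviations, and Statistical Mechanics*, Springer (1985/2006), Thm. II.6.1, Thm. II.6.3,
  §IV.5 (4.33), §IV.6 Lemma IV.6.11, §IV.7, §V.7. [Ellis2006]
* J. L. Lebowitz, *Coexistence of phases in Ising ferromagnets*, J. Stat. Phys. 16 (1977) 463–476, Thms. 2–3. [Lebowitz1977]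
* S. Friedli, Y. Velenik, *Statistical Mechanics of Lattice Systems*, CUP (2017), Thm. 3.6, Exercise 3.17. [FriedliVelenik2017]
* O. E. Lanford, *Entropy and equilibrium states in classical statistical mechanics*, LNP 20 (1973). [Lanford1973]
-/

noncomputable section

namespace Summit.CriticalPhenomena.PercolationContinuityZ3.Theorems.FK

namespace IsingLargeDeviations

open MeasureTheory ProbabilityTheory Filter Topology Finset Set
open Literature.Probability.LatticeModels

/-! ### Finite volume: the inverse temperature tilts the Gibbs measure by the energy -/

section FiniteVolume

variable {V : Type*} (G : SimpleGraph V) [DecidableEq V] [G.LocallyFinite]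

/-- `e^{t(−H_Λ)}` is integrable under any finite measure (`H_Λ` is bounded and measurable). [folklore] -/
theorem integrable_exp_mul_neg_isingHamiltonian (Λ : Finset V) (h : ℝ) (bc : BoundaryCondition V)
    (μ : Measure (SpinConfig V)) [IsFiniteMeasure μ] (t : ℝ) :
    Integrable (fun σ : SpinConfig V => Real.exp (t * -isingHamiltonian G Λ h bc σ)) μ := by
  set C : ℝ := #(edgesTouching G Λ) + |h| * #Λ
  refine Integrable.mono' (integrable_const (Real.exp (|t| * C)))
    ((measurable_isingHamiltonian G Λ h bc).neg.const_mul t).exp.aestronglyMeasurable (ae_of_all _ fun σ => ?_)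
  rw [Real.norm_eq_abs, abs_of_pos (Real.exp_pos _), Real.exp_le_exp]
  calc t * -isingHamiltonian G Λ h bc σ ≤ |t * -isingHamiltonian G Λ h bc σ| := le_abs_self _
    _ = |t| * |isingHamiltonian G Λ h bc σ| := by rw [abs_mul, abs_neg]
    _ ≤ |t| * C := mul_le_mul_of_nonneg_left (abs_isingHamiltonian_le G Λ h bc σ) (abs_nonneg t)

/-- **`μ^{bc}_{Λ;β+s,h} = μ^{bc}_{Λ;β,h}` tilted by `e^{−s H_Λ}`**: the Gibbs measures form an exponential family in `β`
with natural observable the energy. [cite: Ellis2006, §IV.7 and §VII.3 (tilted measures)] -/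
theorem isingMeasure_add_beta_eq_tilted (Λ : Finset V) (β s h : ℝ) (bc : BoundaryCondition V) :
    isingMeasure G Λ (β + s) h bc =
      (isingMeasure G Λ β h bc).tilted fun σ => s * -isingHamiltonian G Λ h bc σ := by
  rw [isingMeasure, isingMeasure, tilted_tilted (integrable_exp_isingHamiltonian G Λ β h bc)]
  congr 1
  funext σ
  simp only [Pi.add_apply]
  ring

/-- **`∫ e^{−s H_Λ} dμ^{bc}_{Λ;β,h} = Z^{bc}_{Λ;β+s,h} / Z^{bc}_{Λ;β,h}`** (every real `β, s, h`, every boundary condition, every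
locally finite graph). [cite: Ellis2006, §IV.7 (free energy function of the energy) and §IV.5 eq. (4.33)] -/
theorem integral_exp_neg_mul_isingHamiltonian (Λ : Finset V) (β s h : ℝ) (bc : BoundaryCondition V) :
    ∫ σ, Real.exp (s * -isingHamiltonian G Λ h bc σ) ∂isingMeasure G Λ β h bc =
      isingPartitionFunction G Λ (β + s) h bc / isingPartitionFunction G Λ β h bc := by
  rw [integral_isingMeasure G Λ β h bc (f := fun σ => Real.exp (s * -isingHamiltonian G Λ h bc σ))
    ((measurable_isingHamiltonian G Λ h bc).neg.const_mul s).exp, isingPartitionFunction, isingPartitionFunction]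
  congr 1
  refine sum_congr rfl fun τ _ => ?_
  rw [isingWeight, isingWeight, ← Real.exp_add]
  congr 1
  ring

/-- **`mgf_{−H_Λ}(s) = Z_{β+s}/Z_β`** under `μ^{bc}_{Λ;β,h}`. [cite: Ellis2006, §IV.7] -/
theorem mgf_neg_isingHamiltonian (Λ : Finset V) (β s h : ℝ) (bc : BoundaryCondition V) :
    mgf (fun σ => -isingHamiltonian G Λ h bc σ) (isingMeasure G Λ β h bc) s =
      isingPartitionFunction G Λ (β + s) h bc / isingPartitionFunction G Λ β h bc := by
  rw [mgf]
  exact integral_exp_neg_mul_isingHamiltonian G Λ β s h bc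

/-- **`cgf_{−H_Λ}(s) = log Z_{β+s} − log Z_β`** under `μ^{bc}_{Λ;β,h}`. [cite: Ellis2006, §IV.7 and eq. (4.33)] -/
theorem cgf_neg_isingHamiltonian (Λ : Finset V) (β s h : ℝ) (bc : BoundaryCondition V) :
    cgf (fun σ => -isingHamiltonian G Λ h bc σ) (isingMeasure G Λ β h bc) s =
      Real.log (isingPartitionFunction G Λ (β + s) h bc) - Real.log (isingPartitionFunction G Λ β h bc) := by
  rw [cgf, mgf_neg_isingHamiltonian, Real.log_div (isingPartitionFunction_pos G Λ _ h bc).ne'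
    (isingPartitionFunction_pos G Λ β h bc).ne']

/-- **`cgf_{−H_Λ}(s) = |Λ| (ψ^{bc}_Λ(β+s,h) − ψ^{bc}_Λ(β,h))`** (nonempty `Λ`). [cite: Ellis2006, §IV.7 and eq. (4.33)] -/
theorem cgf_neg_isingHamiltonian_eq_card_mul {Λ : Finset V} (hΛ : Λ.Nonempty) (β s h : ℝ)
    (bc : BoundaryCondition V) :
    cgf (fun σ => -isingHamiltonian G Λ h bc σ) (isingMeasure G Λ β h bc) s =
      #Λ * (pressureIn G Λ (β + s) h bc - pressureIn G Λ β h bc) := by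
  rw [cgf_neg_isingHamiltonian, log_isingPartitionFunction_eq_card_mul_pressureIn G hΛ,
    log_isingPartitionFunction_eq_card_mul_pressureIn G hΛ, mul_sub]

/-- `Z_{β+s}/Z_β = exp(|Λ| (ψ_Λ(β+s) − ψ_Λ(β)))` (nonempty `Λ`). [cite: Ellis2006, §IV.7] -/
theorem isingPartitionFunction_beta_div_eq_exp_card_mul {Λ : Finset V} (hΛ : Λ.Nonempty) (β s h : ℝ)
    (bc : BoundaryCondition V) :
    isingPartitionFunction G Λ (β + s) h bc / isingPartitionFunction G Λ β h bc =
      Real.exp (#Λ * (pressureIn G Λ (β + s) h bc - pressureIn G Λ β h bc)) := by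
  rw [← cgf_neg_isingHamiltonian_eq_card_mul G hΛ, cgf, mgf_neg_isingHamiltonian,
    Real.exp_log (div_pos (isingPartitionFunction_pos G Λ _ h bc) (isingPartitionFunction_pos G Λ β h bc))]

/-- **CHERNOFF, UPPER TAIL OF THE ENERGY: `μ^{bc}_{Λ;β,h}{a ≤ −H_Λ} ≤ e^{−sa} Z_{β+s}/Z_β`** for `s ≥ 0`.
[cite: Ellis2006, Thm. II.6.1 (b) (proof) with §IV.7] -/
theorem measureReal_le_neg_isingHamiltonian_le (Λ : Finset V) (β : ℝ) {s : ℝ} (hs : 0 ≤ s) (h : ℝ)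
    (bc : BoundaryCondition V) (a : ℝ) :
    (isingMeasure G Λ β h bc).real {σ | a ≤ -isingHamiltonian G Λ h bc σ} ≤
      Real.exp (-(s * a)) * (isingPartitionFunction G Λ (β + s) h bc / isingPartitionFunction G Λ β h bc) := by
  have hb := measure_ge_le_exp_mul_mgf (μ := isingMeasure G Λ β h bc)
    (X := fun σ : SpinConfig V => -isingHamiltonian G Λ h bc σ) a hs
    (integrable_exp_mul_neg_isingHamiltonian G Λ h bc (isingMeasure G Λ β h bc) s)
  rwa [mgf_neg_isingHamiltonian, neg_mul] at hb

/-- **CHERNOFF, LOWER TAIL OF THE ENERGY: `μ^{bc}_{Λ;β,h}{−H_Λ ≤ a} ≤ e^{sa} Z_{β−s}/Z_β`** for `s ≥ 0`.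
[cite: Ellis2006, Thm. II.6.1 (b) (proof) with §IV.7] -/
theorem measureReal_neg_isingHamiltonian_le_le (Λ : Finset V) (β : ℝ) {s : ℝ} (hs : 0 ≤ s) (h : ℝ)
    (bc : BoundaryCondition V) (a : ℝ) :
    (isingMeasure G Λ β h bc).real {σ | -isingHamiltonian G Λ h bc σ ≤ a} ≤
      Real.exp (s * a) * (isingPartitionFunction G Λ (β - s) h bc / isingPartitionFunction G Λ β h bc) := by
  have ht : -s ≤ 0 := by linarith
  have hb := measure_le_le_exp_mul_mgf (μ := isingMeasure G Λ β h bc)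
    (X := fun σ : SpinConfig V => -isingHamiltonian G Λ h bc σ) a ht
    (integrable_exp_mul_neg_isingHamiltonian G Λ h bc (isingMeasure G Λ β h bc) (-s))
  rw [mgf_neg_isingHamiltonian, ← sub_eq_add_neg] at hb
  refine hb.trans (le_of_eq ?_)
  congr 2
  ring

/-- **UPPER TAIL IN PRESSURE FORM: `μ^{bc}_{Λ;β,h}{u|Λ| ≤ −H_Λ} ≤ exp(−|Λ| (su − (ψ^{bc}_Λ(β+s,h) − ψ^{bc}_Λ(β,h))))`**
(`s ≥ 0`, nonempty `Λ`). [cite: Ellis2006, Thm. II.6.1 (b) with §IV.7] -/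
theorem measureReal_le_neg_isingHamiltonian_le_exp_card {Λ : Finset V} (hΛ : Λ.Nonempty) (β : ℝ) {s : ℝ}
    (hs : 0 ≤ s) (h : ℝ) (bc : BoundaryCondition V) (u : ℝ) :
    (isingMeasure G Λ β h bc).real {σ | u * #Λ ≤ -isingHamiltonian G Λ h bc σ} ≤
      Real.exp (-(#Λ * (s * u - (pressureIn G Λ (β + s) h bc - pressureIn G Λ β h bc)))) := by
  refine (measureReal_le_neg_isingHamiltonian_le G Λ β hs h bc (u * #Λ)).trans (le_of_eq ?_)
  rw [isingPartitionFunction_beta_div_eq_exp_card_mul G hΛ, ← Real.exp_add]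
  congr 1
  ring

/-- **LOWER TAIL IN PRESSURE FORM: `μ^{bc}_{Λ;β,h}{−H_Λ ≤ u|Λ|} ≤ exp(−|Λ| (−su − (ψ^{bc}_Λ(β−s,h) − ψ^{bc}_Λ(β,h))))`**
(`s ≥ 0`, nonempty `Λ`). [cite: Ellis2006, Thm. II.6.1 (b) with §IV.7] -/
theorem measureReal_neg_isingHamiltonian_le_le_exp_card {Λ : Finset V} (hΛ : Λ.Nonempty) (β : ℝ) {s : ℝ}
    (hs : 0 ≤ s) (h : ℝ) (bc : BoundaryCondition V) (u : ℝ) :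
    (isingMeasure G Λ β h bc).real {σ | -isingHamiltonian G Λ h bc σ ≤ u * #Λ} ≤
      Real.exp (-(#Λ * (-(s * u) - (pressureIn G Λ (β - s) h bc - pressureIn G Λ β h bc)))) := by
  refine (measureReal_neg_isingHamiltonian_le_le G Λ β hs h bc (u * #Λ)).trans (le_of_eq ?_)
  rw [sub_eq_add_neg β s, isingPartitionFunction_beta_div_eq_exp_card_mul G hΛ, ← Real.exp_add, ← sub_eq_add_neg]
  congr 1
  ring

end FiniteVolume

/-! ### `ℤ^d`: large-deviation upper bounds for the energy density and exponential concentration -/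

variable {d : ℕ}

/-- **LD UPPER BOUND, UPPER HALF-LINE**: for `s ≥ 0`, every `u`, `ε > 0`, `bc`, eventually
`μ^{bc}_{Λ_N;β,h}{u|Λ_N| ≤ −H_N} ≤ exp(−|Λ_N| (su − (ψ(β+s,h) − ψ(β,h)) − ε))`. [cite: Ellis2006, Thm. II.6.1 (b) with §IV.7] -/
theorem eventually_measureReal_le_neg_isingHamiltonian_le (β : ℝ) {s : ℝ} (hs : 0 ≤ s) (h : ℝ)
    (bc : BoundaryCondition (Site d)) (u : ℝ) {ε : ℝ} (hε : 0 < ε) :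
    ∀ᶠ N : ℕ in atTop,
      (isingMeasure (zdGraph d) (box d N) β h bc).real
          {σ | u * #(box d N) ≤ -isingHamiltonian (zdGraph d) (box d N) h bc σ} ≤
        Real.exp (-(#(box d N) * (s * u - (pressure d (β + s) h - pressure d β h) - ε))) := by
  have hlim : Tendsto (fun N : ℕ => pressureIn (zdGraph d) (box d N) (β + s) h bc - pressureIn (zdGraph d) (box d N) β h bc)
      atTop (𝓝 (pressure d (β + s) h - pressure d β h)) :=
    (hasBoxLimit_pressureIn_holds (d := d) (β + s) h bc).sub (hasBoxLimit_pressureIn_holds (d := d) β h bc)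
  filter_upwards [hlim.eventually (gt_mem_nhds (by linarith : pressure d (β + s) h - pressure d β h <
    pressure d (β + s) h - pressure d β h + ε))] with N hN
  refine (measureReal_le_neg_isingHamiltonian_le_exp_card (zdGraph d) (box_nonempty d N) β hs h bc u).trans ?_
  rw [Real.exp_le_exp]
  have hpos : (0 : ℝ) < #(box d N) := by exact_mod_cast (box_nonempty d N).card_pos
  nlinarith

/-- **LD UPPER BOUND, LOWER HALF-LINE**: for `s ≥ 0`, eventually
`μ^{bc}_{Λ_N;β,h}{−H_N ≤ u|Λ_N|} ≤ exp(−|Λ_N| (−su − (ψ(β−s,h) − ψ(β,h)) − ε))`. [cite: Ellis2006, Thm. II.6.1 (b) with §IV.7] -/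
theorem eventually_measureReal_neg_isingHamiltonian_le_le (β : ℝ) {s : ℝ} (hs : 0 ≤ s) (h : ℝ)
    (bc : BoundaryCondition (Site d)) (u : ℝ) {ε : ℝ} (hε : 0 < ε) :
    ∀ᶠ N : ℕ in atTop,
      (isingMeasure (zdGraph d) (box d N) β h bc).real
          {σ | -isingHamiltonian (zdGraph d) (box d N) h bc σ ≤ u * #(box d N)} ≤
        Real.exp (-(#(box d N) * (-(s * u) - (pressure d (β - s) h - pressure d β h) - ε))) := by
  have hlim : Tendsto (fun N : ℕ => pressureIn (zdGraph d) (box d N) (β - s) h bc - pressureIn (zdGraph d) (box d N) β h bc)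
      atTop (𝓝 (pressure d (β - s) h - pressure d β h)) :=
    (hasBoxLimit_pressureIn_holds (d := d) (β - s) h bc).sub (hasBoxLimit_pressureIn_holds (d := d) β h bc)
  filter_upwards [hlim.eventually (gt_mem_nhds (by linarith : pressure d (β - s) h - pressure d β h <
    pressure d (β - s) h - pressure d β h + ε))] with N hN
  refine (measureReal_neg_isingHamiltonian_le_le_exp_card (zdGraph d) (box_nonempty d N) β hs h bc u).trans ?_
  rw [Real.exp_le_exp]
  have hpos : (0 : ℝ) < #(box d N) := by exact_mod_cast (box_nonempty d N).card_pos
  nlinarith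

/-- **One-sided derivative ⇒ positive rate (pure)**: if `f` has right derivative `D < u` at `x` within `[x,∞)`, then
`0 < su − (f(x+s) − f x)` for some `s > 0`. [cite: Ellis2006, Thm. II.6.3 (proof, §VII.6)] -/
theorem exists_pos_rate_of_hasDerivWithinAt_Ici {f : ℝ → ℝ} {x D u : ℝ} (hD : HasDerivWithinAt f D (Ici x) x)
    (hu : D < u) : ∃ s : ℝ, 0 < s ∧ 0 < s * u - (f (x + s) - f x) := by
  have hslope : Tendsto (fun t => slope f x t) (𝓝[>] x) (𝓝 D) := by
    have := (hasDerivWithinAt_iff_tendsto_slope' (notMem_Ioi.2 le_rfl)).1 (hD.mono Ioi_subset_Ici_self)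
    simpa using this
  have hev : ∀ᶠ t in 𝓝[>] x, slope f x t < (D + u) / 2 := hslope.eventually (gt_mem_nhds (by linarith))
  obtain ⟨t, ht1, ht2⟩ := (hev.and (eventually_mem_nhdsWithin (a := x) (s := Ioi x))).exists
  have hs : 0 < t - x := sub_pos.2 ht2
  refine ⟨t - x, hs, ?_⟩
  rw [slope_def_field] at ht1
  have h1 := (div_lt_iff₀ hs).1 ht1
  rw [add_sub_cancel]
  nlinarith

/-- **Left derivative `D > u` ⇒ `0 < −su − (f(x−s) − f x)` for some `s > 0`** (pure). [cite: Ellis2006, Thm. II.6.3 (proof, §VII.6)] -/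
theorem exists_pos_rate_of_hasDerivWithinAt_Iic {f : ℝ → ℝ} {x D u : ℝ} (hD : HasDerivWithinAt f D (Iic x) x)
    (hu : u < D) : ∃ s : ℝ, 0 < s ∧ 0 < -(s * u) - (f (x - s) - f x) := by
  have hslope : Tendsto (fun t => slope f x t) (𝓝[<] x) (𝓝 D) := by
    have := (hasDerivWithinAt_iff_tendsto_slope' (notMem_Iio.2 le_rfl)).1 (hD.mono Iio_subset_Iic_self)
    simpa using this
  have hev : ∀ᶠ t in 𝓝[<] x, (D + u) / 2 < slope f x t := hslope.eventually (lt_mem_nhds (by linarith))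
  obtain ⟨t, ht1, ht2⟩ := (hev.and (eventually_mem_nhdsWithin (a := x) (s := Iio x))).exists
  have hs : 0 < x - t := sub_pos.2 ht2
  refine ⟨x - t, hs, ?_⟩
  rw [slope_def_field] at ht1
  have hneg : t - x < 0 := by linarith
  have h1 := (lt_div_iff_of_neg hneg).1 ht1
  rw [sub_sub_cancel]
  nlinarith

/-- **UPPER TAIL OF THE ENERGY FROM THE RIGHT `β`-DERIVATIVE**: if `∂⁺ψ/∂β (β,h) = D < u` then for some `c > 0` and every
boundary condition, eventually `μ^{bc}_{Λ_N;β,h}{u|Λ_N| ≤ −H_N} ≤ e^{−c|Λ_N|}`. [cite: Ellis2006, Thm. II.6.3 with §IV.7; Lanford1973] -/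
theorem energy_upper_tail_exp_decay_of_hasDerivWithinAt {β h D u : ℝ}
    (hD : HasDerivWithinAt (fun b => pressure d b h) D (Ici β) β) (hu : D < u) :
    ∃ c : ℝ, 0 < c ∧ ∀ bc : BoundaryCondition (Site d), ∀ᶠ N : ℕ in atTop,
      (isingMeasure (zdGraph d) (box d N) β h bc).real
          {σ | u * #(box d N) ≤ -isingHamiltonian (zdGraph d) (box d N) h bc σ} ≤ Real.exp (-(c * #(box d N))) := by
  obtain ⟨s, hs, hrate⟩ := exists_pos_rate_of_hasDerivWithinAt_Ici hD hu
  refine ⟨(s * u - (pressure d (β + s) h - pressure d β h)) / 2, by linarith, fun bc => ?_⟩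
  filter_upwards [eventually_measureReal_le_neg_isingHamiltonian_le (d := d) β hs.le h bc u (half_pos hrate)] with N hN
  refine hN.trans (le_of_eq ?_)
  congr 1
  ring

/-- **LOWER TAIL OF THE ENERGY FROM THE LEFT `β`-DERIVATIVE**: if `u < D = ∂⁻ψ/∂β (β,h)` then for some `c > 0` and every
boundary condition, eventually `μ^{bc}_{Λ_N;β,h}{−H_N ≤ u|Λ_N|} ≤ e^{−c|Λ_N|}`. [cite: Ellis2006, Thm. II.6.3 with §IV.7; Lanford1973] -/
theorem energy_lower_tail_exp_decay_of_hasDerivWithinAt {β h D u : ℝ}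
    (hD : HasDerivWithinAt (fun b => pressure d b h) D (Iic β) β) (hu : u < D) :
    ∃ c : ℝ, 0 < c ∧ ∀ bc : BoundaryCondition (Site d), ∀ᶠ N : ℕ in atTop,
      (isingMeasure (zdGraph d) (box d N) β h bc).real
          {σ | -isingHamiltonian (zdGraph d) (box d N) h bc σ ≤ u * #(box d N)} ≤ Real.exp (-(c * #(box d N))) := by
  obtain ⟨s, hs, hrate⟩ := exists_pos_rate_of_hasDerivWithinAt_Iic hD hu
  refine ⟨(-(s * u) - (pressure d (β - s) h - pressure d β h)) / 2, by linarith, fun bc => ?_⟩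
  filter_upwards [eventually_measureReal_neg_isingHamiltonian_le_le (d := d) β hs.le h bc u (half_pos hrate)] with N hN
  refine hN.trans (le_of_eq ?_)
  congr 1
  ring

/-- **THE EXPONENTIAL LAW OF LARGE NUMBERS FOR THE ENERGY DENSITY WHERE `ψ(·,h)` IS DIFFERENTIABLE** (`d ≥ 1`): if
`HasDerivAt ψ(·,h) D β` then for every `ε > 0` there is `c > 0` with `μ^{bc}_{Λ_N;β,h}{ε ≤ |−H_N/|Λ_N| − D|} ≤ e^{−c|Λ_N|}`
eventually, for every boundary condition. [cite: Ellis2006, Thm. II.6.3 (b) ⇒ (a) with §IV.7; Lanford1973] -/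
theorem energy_exp_concentration_of_hasDerivAt (hd : 1 ≤ d) {β h D : ℝ}
    (hD : HasDerivAt (fun b => pressure d b h) D β) {ε : ℝ} (hε : 0 < ε) :
    ∃ c : ℝ, 0 < c ∧ ∀ bc : BoundaryCondition (Site d), ∀ᶠ N : ℕ in atTop,
      (isingMeasure (zdGraph d) (box d N) β h bc).real
          {σ | ε ≤ |(-isingHamiltonian (zdGraph d) (box d N) h bc σ) / #(box d N) - D|} ≤
        Real.exp (-(c * #(box d N))) := by
  obtain ⟨c₁, hc₁, h₁⟩ := energy_upper_tail_exp_decay_of_hasDerivWithinAt (d := d) (u := D + ε)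
    hD.hasDerivWithinAt (by linarith)
  obtain ⟨c₂, hc₂, h₂⟩ := energy_lower_tail_exp_decay_of_hasDerivWithinAt (d := d) (u := D - ε)
    hD.hasDerivWithinAt (by linarith)
  refine ⟨min c₁ c₂ / 2, by positivity, fun bc => ?_⟩
  filter_upwards [h₁ bc, h₂ bc, eventually_exp_add_exp_le hd hc₁ hc₂] with N hN₁ hN₂ hN
  have hV : (0 : ℝ) < #(box d N) := by exact_mod_cast (box_nonempty d N).card_pos
  have hsub : {σ : SpinConfig (Site d) | ε ≤ |(-isingHamiltonian (zdGraph d) (box d N) h bc σ) / #(box d N) - D|} ⊆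
      {σ | (D + ε) * #(box d N) ≤ -isingHamiltonian (zdGraph d) (box d N) h bc σ} ∪
        {σ | -isingHamiltonian (zdGraph d) (box d N) h bc σ ≤ (D - ε) * #(box d N)} := by
    intro σ hσ
    simp only [mem_setOf_eq, Set.mem_union] at hσ ⊢
    rcases le_abs'.1 hσ with h1 | h1
    · right
      have h2 : (-isingHamiltonian (zdGraph d) (box d N) h bc σ) / #(box d N) ≤ D - ε := by linarith
      rwa [div_le_iff₀ hV] at h2
    · left
      have h2 : D + ε ≤ (-isingHamiltonian (zdGraph d) (box d N) h bc σ) / #(box d N) := by linarith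
      rwa [le_div_iff₀ hV] at h2
  exact ((measureReal_mono hsub).trans (measureReal_union_le _ _)).trans ((add_le_add hN₁ hN₂).trans hN)

/-! ### The Ising specialisations -/

/-- **AT `h = 0`, EVERY `β ≥ 0`, EVERY b.c.: the energy density does not exceed the `+` nearest-neighbour energy** —
for `u > Σᵢ ⟨σ_0σ_{eᵢ}⟩⁺_β`, eventually `μ^{bc}_{Λ_N;β,0}{u|Λ_N| ≤ −H_N} ≤ e^{−c|Λ_N|}` (`∂⁺ψ/∂β(β,0) = Σᵢ⟨σ_0σ_{eᵢ}⟩⁺_β`).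
[cite: Lebowitz1977, §3 Thm. 2; Ellis2006, Thm. II.6.3 and §IV.7] -/
theorem energy_upper_tail_exp_decay_plus_nn {β : ℝ} (hβ : 0 ≤ β) {u : ℝ}
    (hu : ∑ i, plusCorr d β 0 {0, Pi.single i 1} < u) :
    ∃ c : ℝ, 0 < c ∧ ∀ bc : BoundaryCondition (Site d), ∀ᶠ N : ℕ in atTop,
      (isingMeasure (zdGraph d) (box d N) β 0 bc).real
          {σ | u * #(box d N) ≤ -isingHamiltonian (zdGraph d) (box d N) 0 bc σ} ≤ Real.exp (-(c * #(box d N))) :=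
  energy_upper_tail_exp_decay_of_hasDerivWithinAt (IsingEnergyDensity.hasDerivWithinAt_pressure_beta_Ici (d := d) hβ) hu

/-- **AT `h = 0`, EVERY `β > 0`, EVERY b.c.: the energy density does not fall below the free nearest-neighbour energy**
— for `u < Σᵢ ⟨σ_0σ_{eᵢ}⟩^∅_β`, eventually `μ^{bc}_{Λ_N;β,0}{−H_N ≤ u|Λ_N|} ≤ e^{−c|Λ_N|}`
(`∂⁻ψ/∂β(β,0) = Σᵢ⟨σ_0σ_{eᵢ}⟩^∅_β`). [cite: Lebowitz1977, §3 Thm. 2; Ellis2006, Thm. II.6.3 and §IV.7] -/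
theorem energy_lower_tail_exp_decay_free_nn {β : ℝ} (hβ : 0 < β) {u : ℝ}
    (hu : u < ∑ i, freeCorr d β 0 {0, Pi.single i 1}) :
    ∃ c : ℝ, 0 < c ∧ ∀ bc : BoundaryCondition (Site d), ∀ᶠ N : ℕ in atTop,
      (isingMeasure (zdGraph d) (box d N) β 0 bc).real
          {σ | -isingHamiltonian (zdGraph d) (box d N) 0 bc σ ≤ u * #(box d N)} ≤ Real.exp (-(c * #(box d N))) :=
  energy_lower_tail_exp_decay_of_hasDerivWithinAt (IsingEnergyDensity.hasDerivWithinAt_pressure_beta_Iic (d := d) hβ) hu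

/-- **LEBOWITZ' CRITERION ⇒ EXPONENTIAL LLN FOR THE ENERGY AT `h = 0`**: if `Σᵢ⟨σ_0σ_{eᵢ}⟩^∅_β = Σᵢ⟨σ_0σ_{eᵢ}⟩⁺_β` (`β > 0`,
`d ≥ 1`) then `−H_N/|Λ_N| →exp Σᵢ⟨σ_0σ_{eᵢ}⟩⁺_β` under every boundary condition. [cite: Lebowitz1977, Thm. 2; Ellis2006, Thm. II.6.3] -/
theorem energy_exp_concentration_of_nn_freeCorr_eq_plusCorr (hd : 1 ≤ d) {β : ℝ} (hβ : 0 < β)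
    (heq : ∑ i, freeCorr d β 0 {0, Pi.single i 1} = ∑ i, plusCorr d β 0 {0, Pi.single i 1}) {ε : ℝ} (hε : 0 < ε) :
    ∃ c : ℝ, 0 < c ∧ ∀ bc : BoundaryCondition (Site d), ∀ᶠ N : ℕ in atTop,
      (isingMeasure (zdGraph d) (box d N) β 0 bc).real
          {σ | ε ≤ |(-isingHamiltonian (zdGraph d) (box d N) 0 bc σ) / #(box d N) - ∑ i, plusCorr d β 0 {0, Pi.single i 1}|} ≤
        Real.exp (-(c * #(box d N))) :=
  energy_exp_concentration_of_hasDerivAt hd (IsingEnergyDensity.hasDerivAt_pressure_beta_of_sum_eq (d := d) hβ heq) hε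

/-- **EXPONENTIAL LLN FOR THE ENERGY DENSITY AT `h = 0` FOR `0 < β ≤ β_c(d)`, `d ≥ 2`**: `−H_N/|Λ_N| →exp Σᵢ⟨σ_0σ_{eᵢ}⟩⁺_β`
under every boundary condition (the pressure is `C¹` in `β` on `(0, β_c]`). [cite: Ellis2006, Thm. II.6.3 and Thm. V.6.1; AizenmanDuminilCopinSidoraviciusCMP2015, Thm. 1.3 (continuity at β_c)] -/
theorem energy_exp_concentration_of_le_criticalBeta (hd : 2 ≤ d) {β : ℝ} (hβ : 0 < β) (hβc : β ≤ criticalBeta d)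
    {ε : ℝ} (hε : 0 < ε) :
    ∃ c : ℝ, 0 < c ∧ ∀ bc : BoundaryCondition (Site d), ∀ᶠ N : ℕ in atTop,
      (isingMeasure (zdGraph d) (box d N) β 0 bc).real
          {σ | ε ≤ |(-isingHamiltonian (zdGraph d) (box d N) 0 bc σ) / #(box d N) - ∑ i, plusCorr d β 0 {0, Pi.single i 1}|} ≤
        Real.exp (-(c * #(box d N))) :=
  energy_exp_concentration_of_hasDerivAt (by omega)
    (IsingEnergyDensity.hasDerivAt_pressure_beta_of_le_criticalBeta (d := d) hd hβ hβc) hε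

/-- **AT THE CRITICAL POINT: NO LATENT HEAT ⇒ THE CRITICAL ENERGY DENSITY CONCENTRATES EXPONENTIALLY** (`d ≥ 2`,
`h = 0`, `β = β_c(d)`, every boundary condition): `−H_N/|Λ_N| →exp Σᵢ⟨σ_0σ_{eᵢ}⟩⁺_{β_c}`.
[cite: Ellis2006, Thm. II.6.3; AizenmanDuminilCopinSidoraviciusCMP2015, Thm. 1.3] -/
theorem energy_exp_concentration_criticalBeta (hd : 2 ≤ d) {ε : ℝ} (hε : 0 < ε) :
    ∃ c : ℝ, 0 < c ∧ ∀ bc : BoundaryCondition (Site d), ∀ᶠ N : ℕ in atTop,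
      (isingMeasure (zdGraph d) (box d N) (criticalBeta d) 0 bc).real
          {σ | ε ≤ |(-isingHamiltonian (zdGraph d) (box d N) 0 bc σ) / #(box d N) -
            ∑ i, plusCorr d (criticalBeta d) 0 {0, Pi.single i 1}|} ≤ Real.exp (-(c * #(box d N))) :=
  energy_exp_concentration_of_hasDerivAt (by omega)
    (IsingEnergyDensity.hasDerivAt_pressure_beta_criticalBeta (d := d) hd) hε

/-- **EXPONENTIAL LLN FOR THE ENERGY DENSITY AT `h > 0`, EVERY `β > 0`** (`d ≥ 1`): `−H_N/|Λ_N| →exp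
Σᵢ⟨σ_0σ_{eᵢ}⟩⁺_{β,h} + h m(β,h)` under every boundary condition (`ψ(·,h)` is `C¹` at `h ≠ 0`).
[cite: Ellis2006, Thm. II.6.3 and Thm. V.6.1 (c); FriedliVelenik2017, Thm. 3.43] -/
theorem energy_exp_concentration_pos_field (hd : 1 ≤ d) {β h : ℝ} (hβ : 0 < β) (hh : 0 < h) {ε : ℝ} (hε : 0 < ε) :
    ∃ c : ℝ, 0 < c ∧ ∀ bc : BoundaryCondition (Site d), ∀ᶠ N : ℕ in atTop,
      (isingMeasure (zdGraph d) (box d N) β h bc).real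
          {σ | ε ≤ |(-isingHamiltonian (zdGraph d) (box d N) h bc σ) / #(box d N) -
            (∑ i, plusCorr d β h {0, Pi.single i 1} + h * magnetizationInField d β h)|} ≤
        Real.exp (-(c * #(box d N))) :=
  energy_exp_concentration_of_hasDerivAt hd (IsingEnergyDensity.hasDerivAt_pressure_beta_of_pos_field (d := d) hd hβ hh) hε

/-- **`d = 2`: EXPONENTIAL LLN FOR THE ENERGY DENSITY AT EVERY `β > 0`, `h = 0`** (the planar pressure has no
`β`-kink at any temperature): `−H_N/|Λ_N| →exp Σᵢ⟨σ_0σ_{eᵢ}⟩⁺_β` under every boundary condition.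
[cite: Ellis2006, Thm. II.6.3; FriedliVelenik2017, Thm. 3.6] -/
theorem energy_exp_concentration_two {β : ℝ} (hβ : 0 < β) {ε : ℝ} (hε : 0 < ε) :
    ∃ c : ℝ, 0 < c ∧ ∀ bc : BoundaryCondition (Site 2), ∀ᶠ N : ℕ in atTop,
      (isingMeasure (zdGraph 2) (box 2 N) β 0 bc).real
          {σ | ε ≤ |(-isingHamiltonian (zdGraph 2) (box 2 N) 0 bc σ) / #(box 2 N) - ∑ i, plusCorr 2 β 0 {0, Pi.single i 1}|} ≤
        Real.exp (-(c * #(box 2 N))) :=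
  energy_exp_concentration_of_hasDerivAt (by norm_num) (IsingEnergyDensity.hasDerivAt_pressure_beta_two hβ) hε

end IsingLargeDeviations

end Summit.CriticalPhenomena.PercolationContinuityZ3.Theorems.FK
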